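import Summits.BirchSwinnertonDyer.Rank1Residual.F1Sign2.UnitLocusAtTwo
import Literature.NumberTheory.EllipticCurves.Sprung2017.SharpFlatPAdicLFunction
import Summits.BirchSwinnertonDyer.Rank1Residual.X1.MuLambdaAlgebra
import HarnessLib

/-!
# Cell `bsd-f1-sign2` (`p = 2`, non-CM) — candidate ES-C-C `SharpLambdaUnitCaseAtTwo`: on the unit locus
# at a good supersingular `2`, every Sprung pair `(L♯, L♭)` has `L♭ ∈ Λˣ`, `μ(L♯) = 0`, and `λ(L♯) = 1`
# (`a₂ = ±2`) resp. `λ(L♯)` odd `≥ 3` (`a₂ = 0`) — typed candidate of the Euler-system lens, GRADED APART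
# per refuter-1 (the `a₂ = 0` clause `μ(L♯) = 0` is an OPEN `μ`-statement at `2`)

HONEST FRAMING (typer seat `bsd-f1-sign2-ty`; HOME `run/shared/lean/pub/bsd-f1-sign2/`, CANDIDATES.md §2
row ES-C-C): STATEMENT ONLY — the planner's candidate VERBATIM (`SharpLambdaUnitCaseAtTwo`, source
`HOME/data-es/Sketch.lean` bcb79e6976fcc0bd) and its three GRADED PARTS as separate `@[conjecture] def`s,
with the PROVED equivalence `sharpLambdaUnitCaseAtTwo_iff_parts`; nothing asserted, nothing booked, no
named fact, PARTITION: none moved. REFUTER PASS: REF1-AUDIT-v1.md §1 — **SURVIVES, NARROW / SPLIT**: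
(i) `IsUnit Lflat` from `UnitLValueAtTwo` needs `ϖ = Ω⁺_f/Ω_E ∈ ℤ₂ˣ` = Abbes–Ullmo 1996 Thm. A at `2`
(tree named fact `abbesUllmo_not_dvd_maninConstant_of_not_dvd_level`, statement-only, IN PRINT — a hidden
but printed side fact; the tree proves `interpolationUnit_flat_two_of_goodSS`); (ii) the ♯ constant term is
a LANDED theorem (`Theorems.constantCoeff_sharp_two_of_isSprungPair_of_isNewformOf`: `L♯(0) =
(−a³+2a²+3a−4)·[0]⁺_f` for ANY Sprung pair at `2`); (iii) `a₂ = ±2`: `L♯ = (T+2)·G`, `v₂ G(0) = 0` ⇒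
`G ∈ Λˣ` ⇒ `μ♯ = 0, λ♯ = 1` — IN-PRINT ASSEMBLY (Kurihara–Otsuki 2006 Prop. 1.1 / Cor. 1.2 + (ii)) =
part `SharpUnitCaseTraceTwoAtTwo`; (iv) `a₂ = 0`: `G(0) = −2[0]⁺` has `v₂ = 1`, so `μ(L♯) = 0` is NOT
forced by anything in print — an OPEN `μ = 0` assertion at `2` on the unit locus = part
`SharpMuZeroUnitCaseTraceZeroAtTwo`, on which the `λ♯` clause = part `SharpLambdaOddUnitCaseTraceZeroAtTwo`
depends (parity law `even_lam_flat_two_iff` + `(T+2) ∣ L♯`). BC7 CLEAN. REF2: pending at filing.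

BC5 WITNESS (`HOME/data-es/TABLE-ES-UNIT-v1.tsv` 2a816f914e1323f9; MEMO-es §3 T3): `a₂ = ±2` unit rows:
`λ♯ = 1` on **154/154**, `N ≡ ±3 (8)` 154/154 (refuter-1's own join: 106/106 `a₂ = +2` unit rows with
`(λ♯, λ♭) = (1, 0)`); `a₂ = 0` unit rows: `μ♯ = 0` certified and `λ♯` odd `≥ 3` on **116/116**
(distribution 3:51, 5:28, 7:15, 9:9, 11:9, 13:2, 15:2 — the bound `3` is attained), `N mod 8 ∈ {3,5}`
116/116, `L(E,χ₈,1) = 0` flag 116/116. CHEAPEST FALSIFIER: one unit row violating the `λ♯`/`μ♯` law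
(0/270). WHY NOVEL (MEMO-es §3): the `a₂ = 0` `μ♯ = 0` statement at `2` on the unit locus and the
resulting `λ♯ ≥ 3` odd law are not in print (Sprung 2017 Part 2's `λ`-formulas and Kurihara–Otsuki 2006
are `a₂ = ±2` / odd `p`); the `a₂ = ±2` part is assembly of printed results.

References: [Sprung2017] Thm. 1.12, Cor. 4.11 (table: `c♯`, `c♭`); [KuriharaOtsuki2006] Prop. 1.1, Cor. 1.2,
Rem. 0.2(3); [AbbesUllmo1996] Thm. A; HOME MEMO-es.md §3; REF1-AUDIT-v1.md §1.
-/

set_option autoImplicit false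

noncomputable section

open scoped Classical MatrixGroups ModularForm

open CongruenceSubgroup WeierstrassCurve Literature.NumberTheory.EllipticCurves
  Literature.NumberTheory.EllipticCurves.ModularForms Literature.NumberTheory.EllipticCurves.Sprung2017
  Summit.BirchSwinnertonDyer.Rank1Residual.X1.MuLambda

namespace Summit.BirchSwinnertonDyer.Rank1Residual.F1Sign2

/-- **CANDIDATE ES-C-C `SharpLambdaUnitCaseAtTwo` (OPEN; cell `bsd-f1-sign2`, lens `-es`; the planner's
statement VERBATIM).** For `E/ℚ` (globally minimal) with newform `f`, good reduction at `2`, `2 ∣ a₂`,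
`ord₂(L(E,1)/Ω_E) = 0` and `2 ∤ Tam(E)`: for every Sprung pair `(L♯, L♭) ∈ Λ²` at `2`
(`IsSprungPair f 2 a₂ L♯ L♭`), `L♭` is a unit of `Λ` (`λ♭ = μ♭ = 0`), `μ(L♯) = 0`, `λ(L♯) = 1` if
`a₂ ≠ 0`, and `λ(L♯)` is odd and `≥ 3` if `a₂ = 0` (`(T+2) ∣ L♯`, `v₂ c♯ = 2`, parity law). REF1: SURVIVES,
to be GRADED APART (`sharpLambdaUnitCaseAtTwo_iff_parts`): the `a₂ = ±2` part is in-print assembly, the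
`a₂ = 0` clause `μ(L♯) = 0` is an OPEN `μ`-statement at `2`. Witness: 154/154 + 116/116 unit rows.
[cite: Sprung2017, Thm. 1.12 and Cor. 4.11 (the objects `L♯, L♭` and `c♯, c♭`; the statement is NOT in print)] -/
@[conjecture] def SharpLambdaUnitCaseAtTwo : Prop :=
  ∀ (W : WeierstrassCurve ℚ) [W.IsElliptic] [W.IsGloballyMinimal] {N : ℕ} [NeZero N]
    (f : CuspForm (Gamma0 N) 2), IsNewformOf W f →
    W.HasGoodReductionAtPrime 2 → (2 : ℤ) ∣ W.frobeniusTrace 2 → UnitLValueAtTwo W → ¬ 2 ∣ W.tamagawaProduct →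
    ∀ (Lsharp Lflat : IwasawaAlgebra 2), IsSprungPair f 2 (W.frobeniusTrace 2) Lsharp Lflat →
      IsUnit Lflat ∧ mu Lsharp = 0 ∧
      (W.frobeniusTrace 2 ≠ 0 → lam Lsharp = 1) ∧
      (W.frobeniusTrace 2 = 0 → Odd (lam Lsharp) ∧ 3 ≤ lam Lsharp)

/-- **PART (iii) `SharpUnitCaseTraceTwoAtTwo` — the `a₂ = ±2` clauses (IN-PRINT ASSEMBLY grade, REF1):**
on the unit locus with `2 ∤ Tam` and `a₂ ≠ 0` (so `a₂ = ±2`), every Sprung pair at `2` has `L♭ ∈ Λˣ`,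
`μ(L♯) = 0` and `λ(L♯) = 1` (`L♯ = (T+2)·G` with `v₂ G(0) = v₂(c♯[0]⁺) − 1 = 0`: Kurihara–Otsuki 2006
Prop. 1.1 / Cor. 1.2 — `Tam` odd ⇒ `N ≡ ±3 (8)` ⇒ `w(E ⊗ χ₈) = −1` ⇒ `θ₁(χ₈) = 0` ⇒ `L♯(−2) = 0` —
plus the landed constant-term theorem). Witness: `λ♯ = 1` on 154/154 `a₂ = ±2` unit rows.
[cite: KuriharaOtsuki2006, Prop. 1.1 and Cor. 1.2 (ingredients; the assembled statement is ours)] -/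
@[conjecture] def SharpUnitCaseTraceTwoAtTwo : Prop :=
  ∀ (W : WeierstrassCurve ℚ) [W.IsElliptic] [W.IsGloballyMinimal] {N : ℕ} [NeZero N]
    (f : CuspForm (Gamma0 N) 2), IsNewformOf W f →
    W.HasGoodReductionAtPrime 2 → (2 : ℤ) ∣ W.frobeniusTrace 2 → W.frobeniusTrace 2 ≠ 0 →
    UnitLValueAtTwo W → ¬ 2 ∣ W.tamagawaProduct →
    ∀ (Lsharp Lflat : IwasawaAlgebra 2), IsSprungPair f 2 (W.frobeniusTrace 2) Lsharp Lflat →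
      IsUnit Lflat ∧ mu Lsharp = 0 ∧ lam Lsharp = 1

/-- **PART (iv-μ) `SharpMuZeroUnitCaseTraceZeroAtTwo` — the OPEN `μ`-statement at `2` (REF1: "NOT forced
by anything in print I can name"):** on the unit locus with `2 ∤ Tam` and `a₂ = 0`, every Sprung pair at
`2` has `L♭ ∈ Λˣ` and `μ(L♯) = 0` (here `L♯ = (T+2)·G` with `v₂ G(0) = 1`, so `μ(G) = 0` is genuine
content). Witness: `μ♯ = 0` certified on 116/116 `a₂ = 0` unit rows. [folklore] -/
@[conjecture] def SharpMuZeroUnitCaseTraceZeroAtTwo : Prop :=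
  ∀ (W : WeierstrassCurve ℚ) [W.IsElliptic] [W.IsGloballyMinimal] {N : ℕ} [NeZero N]
    (f : CuspForm (Gamma0 N) 2), IsNewformOf W f →
    W.HasGoodReductionAtPrime 2 → W.frobeniusTrace 2 = 0 →
    UnitLValueAtTwo W → ¬ 2 ∣ W.tamagawaProduct →
    ∀ (Lsharp Lflat : IwasawaAlgebra 2), IsSprungPair f 2 (W.frobeniusTrace 2) Lsharp Lflat →
      IsUnit Lflat ∧ mu Lsharp = 0

/-- **PART (iv-λ) `SharpLambdaOddUnitCaseTraceZeroAtTwo` — the `λ♯` law at `a₂ = 0` (depends on part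
(iv-μ) through the parity law `even_lam_flat_two_iff` and `(T+2) ∣ L♯`):** on the unit locus with
`2 ∤ Tam` and `a₂ = 0`, every Sprung pair at `2` has `λ(L♯)` odd and `≥ 3`. Witness: 116/116 (values
3:51, 5:28, 7:15, 9:9, 11:9, 13:2, 15:2). [folklore] -/
@[conjecture] def SharpLambdaOddUnitCaseTraceZeroAtTwo : Prop :=
  ∀ (W : WeierstrassCurve ℚ) [W.IsElliptic] [W.IsGloballyMinimal] {N : ℕ} [NeZero N]
    (f : CuspForm (Gamma0 N) 2), IsNewformOf W f →
    W.HasGoodReductionAtPrime 2 → W.frobeniusTrace 2 = 0 →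
    UnitLValueAtTwo W → ¬ 2 ∣ W.tamagawaProduct →
    ∀ (Lsharp Lflat : IwasawaAlgebra 2), IsSprungPair f 2 (W.frobeniusTrace 2) Lsharp Lflat →
      Odd (lam Lsharp) ∧ 3 ≤ lam Lsharp

/-- **Grading apart is exact**: the planner's `SharpLambdaUnitCaseAtTwo` is EQUIVALENT to the conjunction
of its three parts (case split on `a₂ = 0`; pure logic). [folklore] -/
theorem sharpLambdaUnitCaseAtTwo_iff_parts :
    SharpLambdaUnitCaseAtTwo ↔
      SharpUnitCaseTraceTwoAtTwo ∧ SharpMuZeroUnitCaseTraceZeroAtTwo ∧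
        SharpLambdaOddUnitCaseTraceZeroAtTwo := by
  constructor
  · intro h
    refine ⟨?_, ?_, ?_⟩
    · intro W _ _ N _ f hf hgood hdvd hne hu htam Ls Lf hpair
      obtain ⟨h1, h2, h3, -⟩ := h W f hf hgood hdvd hu htam Ls Lf hpair
      exact ⟨h1, h2, h3 hne⟩
    · intro W _ _ N _ f hf hgood h0 hu htam Ls Lf hpair
      have hdvd : (2 : ℤ) ∣ W.frobeniusTrace 2 := by rw [h0]; exact dvd_zero 2
      obtain ⟨h1, h2, -, -⟩ := h W f hf hgood hdvd hu htam Ls Lf hpair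
      exact ⟨h1, h2⟩
    · intro W _ _ N _ f hf hgood h0 hu htam Ls Lf hpair
      have hdvd : (2 : ℤ) ∣ W.frobeniusTrace 2 := by rw [h0]; exact dvd_zero 2
      obtain ⟨-, -, -, h4⟩ := h W f hf hgood hdvd hu htam Ls Lf hpair
      exact h4 h0
  · rintro ⟨hA, hB, hC⟩ W _ _ N _ f hf hgood hdvd hu htam Ls Lf hpair
    by_cases h0 : W.frobeniusTrace 2 = 0
    · obtain ⟨h1, h2⟩ := hB W f hf hgood h0 hu htam Ls Lf hpair
      exact ⟨h1, h2, fun hne ↦ absurd h0 hne, fun _ ↦ hC W f hf hgood h0 hu htam Ls Lf hpair⟩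
    · obtain ⟨h1, h2, h3⟩ := hA W f hf hgood hdvd h0 hu htam Ls Lf hpair
      exact ⟨h1, h2, fun _ ↦ h3, fun h0' ↦ absurd h0' h0⟩

end Summit.BirchSwinnertonDyer.Rank1Residual.F1Sign2

end
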